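import Summits.ValiantsHypothesis.ValiantsHypothesis.Theorems.NcUnbalancedStructure
import Summits.ValiantsHypothesis.ValiantsHypothesis.Theorems.NcSkewPermanent
import HarnessLib

/-!
# The unbalance dial, rank half: `LID_r` against `(w+2)`-unbalanced noncommutative circuits

Workshop file for the node `CommutativityDial` (decomp-valiant lens 6 «restricted-models lifting axis»;
offer O-L6-13 «THE UNBALANCE DIAL», FILE 2 of 3; FILE 1 = `NcUnbalancedStructure`). Limaye–Malod–
Srinivasan (ToC 12 (2016), Cor. 5.7): "the lower bounds also hold for `δ`-unbalanced circuits, with a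
loss of `n^{O(δ)}`" (their proof converts to skew circuits). Here the rank half is proved DIRECTLY on
the unbalanced span of FILE 1, for every field:

* §1/§2 the TWO-CUT ROW LEMMA `outerFlat_framed_row₂`: the row `(A, B)` of the outer flattening
  (`NcSkewPermanent.outerFlat`, rows = first `p` and last `p` letters, columns = the middle `m`) of a
  framed body `h_r · g · h̄_{p−s}` whose body has degree `q + m + s` (`r + q = p`, `s ≤ p`; the skew
  case is `s = r`) is a multiple of the row `(A|_{≥r}, B|_{<s})` of the body matrix of `g`; hence
  (`rows_mem_unb`, `rank_outerFlat_unb_le`) **the outer flattening of a member of the unbalanced span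
  with window `[p+m, p+m+w]` over `vals` has rank `≤ |vals| · (p+1) · Σ_{j ≤ w} n^{p+j}`** — LMS16's
  Main Lemma 5.4 with the window: a body of degree `p + m + j` is read with a right block of `r + j`
  letters, `n^j` more rows per notch of the dial.
* §3 **`LID_r` against `(w+2)`-unbalanced circuits** (`lidPoly_unbalanced`): every fan-in-two
  noncommutative circuit computing `LID_r` (`r ≥ 1`) whose product gates are `(w+2)`-unbalanced up to
  degree `4r` (FILE 1's semantic per-gate hypothesis) has **`2^r ≤ (r+1) · (w+1) 2^w · size`**; the
  ends of the dial: `w = 0` recovers the skew bound `2^r ≤ (r+1) · size` of `NcSkewPermanent`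
  (the `example` after `lidPoly_unbalanced`: it re-derives the statement of `NcSkewPermanent.lidPoly_skew`
  verbatim — a landed theorem, hence no named twin here), Def. 5.6 read semantically gives the same
  bound (`lidPoly_degree`), and for
  `2 (w + 2) > 4r` the hypothesis holds for every circuit (FILE 1 `unbalanced_of_lt`) while the bound
  `2^r ≤ (r+1)(w+1)2^w · size` is then weaker than `size ≥ 1` — the dial reads its own ceiling.

HONEST FRAMING: LMS16 Cor. 5.7 (print, p. 12) made explicit for the lifted identity polynomial, new
in the kernel only; a rung of the `CommutativityDial` ladder strictly between the skew rung and the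
open general case (`A_nc`, item 23446: general fan-in-two nc circuits, untouched — LMS16 §8: squares
of palindromes defeat every such partition argument); nothing commutative, nothing on `VP ≠ VNP`.
The permanent along HWY's lift is FILE 3 `NcUnbalancedPermanent`.
-/

noncomputable section

namespace Summit.ValiantsHypothesis.ValiantsHypothesis.Theorems.NcUnbalancedRank

open Literature.Computability.AlgebraicComplexity Literature.Computability.AlgebraicComplexity.ArithCircuit
open Summit.ValiantsHypothesis.ValiantsHypothesis.Theorems.NcAutomatonIntersection
  Summit.ValiantsHypothesis.ValiantsHypothesis.Theorems.NcCentralWidth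
  Summit.ValiantsHypothesis.ValiantsHypothesis.Theorems.NcSOSDegreeFour
  Summit.ValiantsHypothesis.ValiantsHypothesis.Theorems.NcBlockForms
  Summit.ValiantsHypothesis.ValiantsHypothesis.Theorems.NcSkewStructure
  Summit.ValiantsHypothesis.ValiantsHypothesis.Theorems.NcSkewPermanent
  Summit.ValiantsHypothesis.ValiantsHypothesis.Theorems.NcUnbalancedStructure

universe u v

/-! ## §1 The first `s` letters of a word -/

section Lists

variable {σ : Type v}

/-- The first `s ≤ p` letters of the word of `f : Fin p → σ`, as the word of `f ∘ Fin.castLE`.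
[cite: LimayeMalodSrinivasan2016, Lemma 5.4] -/
theorem ofFn_castLE_take {p s : ℕ} (hs : s ≤ p) (f : Fin p → σ) :
    List.ofFn (fun i : Fin s => f (Fin.castLE hs i)) = (List.ofFn f).take s := by
  apply List.ext_getElem
  · simp only [List.length_ofFn, List.length_take]; omega
  · intro i h₁ h₂; simp only [List.getElem_ofFn, List.getElem_take, Fin.castLE_mk]

end Lists

/-! ## §2 The two-cut row lemma and the rank of the outer flattening on an unbalanced span -/

section Flat

variable (K : Type u) [Field K] {σ : Type v} [DecidableEq σ]

/-- **TWO-CUT ROW LEMMA**: the row `(A, B)` of the outer flattening of a framed body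
`h_r · g · h̄_{p−s}` with body degree `q + m + s` (`r + q = p`, `s ≤ p`) is `[A|_{<r}] h · [B|_{≥s}] h̄`
times the row `(A|_{≥r}, B|_{<s})` of the body matrix of `g` (`NcSkewPermanent.outerFlat_framed_row`
is the case `s = r`). [cite: LimayeMalodSrinivasan2016, Lemma 5.4, Cor. 5.7] -/
theorem outerFlat_framed_row₂ {p m r q s d : ℕ} (hrq : r + q = p) (hs : s ≤ p) (hd : p + m + p ≤ d)
    {h g hb : FreeAlgebra K σ} (hh : degPart d r h = h) (hg : degPart d (q + m + s) g = g)
    (hhb : degPart d (p - s) hb = hb) (y : (Fin p → σ) × (Fin p → σ)) :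
    outerFlat K p m (h * g * hb) y =
      (coeff ((List.ofFn y.1).take r) h * coeff ((List.ofFn y.2).drop s) hb) •
        bodyMat K m s q g ((midOf r q hrq y).1, fun i => y.2 (Fin.castLE hs i)) := by
  funext C
  rw [Pi.smul_apply, smul_eq_mul]
  show coeff (List.ofFn y.1 ++ List.ofFn C ++ List.ofFn y.2) (h * g * hb) = _
  have hbody : bodyMat K m s q g ((midOf r q hrq y).1, fun i => y.2 (Fin.castLE hs i)) C =
      coeff ((List.ofFn y.1).drop r ++ List.ofFn C ++ (List.ofFn y.2).take s) g := by
    simp only [bodyMat, ofFn_midOf_fst, ofFn_castLE_take]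
  -- first cut: `(h g) · h̄` at `r + (q + m + s)`
  have hhg : degPart d (r + (q + m + s)) (h * g) = h * g := degPart_mul_of_eq hh hg (by omega)
  have hw : (List.ofFn y.1 ++ List.ofFn C ++ List.ofFn y.2).length = r + (q + m + s) + (p - s) := by
    simp only [List.length_append, List.length_ofFn]; omega
  have step1 :=
    coeff_mul_degPart (d := d) (a := r + (q + m + s)) (b := p - s) (by omega) _ hw (h * g) hb
  rw [hhg, hhb] at step1
  have htake1 : (List.ofFn y.1 ++ List.ofFn C ++ List.ofFn y.2).take (r + (q + m + s)) =
      List.ofFn y.1 ++ List.ofFn C ++ (List.ofFn y.2).take s := by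
    rw [List.take_append, List.take_of_length_le (l := List.ofFn y.1 ++ List.ofFn C)
      (i := r + (q + m + s)) (by simp only [List.length_append, List.length_ofFn]; omega),
      show r + (q + m + s) - (List.ofFn y.1 ++ List.ofFn C).length = s by
        simp only [List.length_append, List.length_ofFn]; omega]
  have hdrop1 : (List.ofFn y.1 ++ List.ofFn C ++ List.ofFn y.2).drop (r + (q + m + s)) =
      (List.ofFn y.2).drop s := by
    rw [List.drop_append, List.drop_of_length_le (l := List.ofFn y.1 ++ List.ofFn C)
      (i := r + (q + m + s)) (by simp only [List.length_append, List.length_ofFn]; omega),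
      List.nil_append, show r + (q + m + s) - (List.ofFn y.1 ++ List.ofFn C).length = s by
        simp only [List.length_append, List.length_ofFn]; omega]
  rw [htake1, hdrop1] at step1
  -- second cut: `h · g` at `r`
  have hw2 : (List.ofFn y.1 ++ List.ofFn C ++ (List.ofFn y.2).take s).length = r + (q + m + s) := by
    simp only [List.length_append, List.length_ofFn, List.length_take]; omega
  have step2 := coeff_mul_degPart (d := d) (a := r) (b := q + m + s) (by omega) _ hw2 h g
  rw [hh, hg] at step2
  have htake2 : (List.ofFn y.1 ++ List.ofFn C ++ (List.ofFn y.2).take s).take r =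
      (List.ofFn y.1).take r := by
    rw [List.take_append_of_le_length (by simp only [List.length_append, List.length_ofFn]; omega),
      List.take_append_of_le_length (by simp only [List.length_ofFn]; omega)]
  have hdrop2 : (List.ofFn y.1 ++ List.ofFn C ++ (List.ofFn y.2).take s).drop r =
      (List.ofFn y.1).drop r ++ List.ofFn C ++ (List.ofFn y.2).take s := by
    rw [List.drop_append_of_le_length (by simp only [List.length_append, List.length_ofFn]; omega),
      List.drop_append_of_le_length (by simp only [List.length_ofFn]; omega)]
  rw [htake2, hdrop2] at step2
  rw [step1, step2, hbody]
  ring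

/-- **ROWS OF AN UNBALANCED SPAN**: every row of the outer flattening (`d = 2p + m`, window
`[p+m, p+m+w]`) of a member of the unbalanced span over `vals` lies in any submodule containing the
rows of the body matrices, read with right blocks of `r + j` letters, of the bodies of degrees
`p + m + j`, `j ≤ w`, `r + j ≤ p`. [cite: LimayeMalodSrinivasan2016, Lemma 5.4, Cor. 5.7] -/
theorem rows_mem_unb {p m d w : ℕ} (hd : p + m + p = d) (vals : List (FreeAlgebra K σ))
    {f : FreeAlgebra K σ} (hf : f ∈ unbSpan (bodies vals d) d (p + m) w d)
    (W : Submodule K ((Fin m → σ) → K))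
    (hW : ∀ v ∈ vals, ∀ (j r : ℕ), j ≤ w → r + j ≤ p →
      ∀ x : (Fin (p - r) → σ) × (Fin (r + j) → σ),
        bodyMat K m (r + j) (p - r) (degPart d (p + m + j) v) x ∈ W) :
    ∀ y, outerFlat K p m f y ∈ W := by
  unfold unbSpan at hf
  induction hf using Submodule.span_induction with
  | mem x hx =>
    obtain ⟨c, r, g, h, hb, hec, hcw, ⟨v, hv, rfl⟩, hcr, hh, hhb, rfl⟩ := hx
    intro y
    have hg' : degPart d (p - r + m + (r + (c - (p + m)))) (degPart d c v) = degPart d c v := by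
      rw [show p - r + m + (r + (c - (p + m))) = c by omega]; exact degPart_idem d c v
    have hhb' : degPart d (p - (r + (c - (p + m)))) hb = hb := by
      rwa [show d - c - r = p - (r + (c - (p + m))) by omega] at hhb
    rw [outerFlat_framed_row₂ K (by omega : r + (p - r) = p) (by omega : r + (c - (p + m)) ≤ p)
      hd.le hh hg' hhb' y]
    have key := hW v hv (c - (p + m)) r (by omega) (by omega)
      ((midOf r (p - r) (by omega) y).1, fun i => y.2 (Fin.castLE (by omega) i))
    rw [show p + m + (c - (p + m)) = c by omega] at key
    exact W.smul_mem _ key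
  | zero => intro y; rw [map_zero]; exact W.zero_mem
  | add f g _ _ hf hg => intro y; rw [map_add]; exact W.add_mem (hf y) (hg y)
  | smul c f _ hf => intro y; rw [map_smul]; exact W.smul_mem c (hf y)

variable [Fintype σ]

/-- **MAIN LEMMA 5.4 WITH A WINDOW** (every field): the outer flattening of a member of the
unbalanced span with window `[p+m, p+m+w]` over `vals` — in particular of the value of a fan-in-two
`(w+2)`-unbalanced circuit, `|vals| = size` (FILE 1, `unbalanced_structure`) — has rank
`≤ |vals| · (p+1) · Σ_{j ≤ w} n^{p+j}`. [cite: LimayeMalodSrinivasan2016, Lemma 5.4, Cor. 5.7] -/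
theorem rank_outerFlat_unb_le {p m d w : ℕ} (hd : p + m + p = d) (vals : List (FreeAlgebra K σ))
    {f : FreeAlgebra K σ} (hf : f ∈ unbSpan (bodies vals d) d (p + m) w d) :
    (outerFlat K p m f).rank ≤
      vals.length * (p + 1) * ∑ j ∈ Finset.range (w + 1), Fintype.card σ ^ (p + j) := by
  classical
  -- the dictionary of body rows: (which value, notch `j`, left frame length `r`, row index)
  let Φ : Fin vals.length × ((j : Fin (w + 1)) × ((r : Fin (p + 1)) ×
      ((Fin (p - r.val) → σ) × (Fin (r.val + j.val) → σ)))) → (Fin m → σ) → K := fun i =>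
    bodyMat K m (i.2.2.1.val + i.2.1.val) (p - i.2.2.1.val) (degPart d (p + m + i.2.1.val) vals[i.1])
      i.2.2.2
  have hrows : ∀ y, outerFlat K p m f y ∈ Submodule.span K (Set.range Φ) := by
    refine rows_mem_unb K hd vals hf _ fun v hv j r hj hr x => ?_
    obtain ⟨i, hi, rfl⟩ := List.mem_iff_getElem.1 hv
    exact Submodule.subset_span ⟨⟨⟨i, hi⟩, ⟨j, by omega⟩, ⟨r, by omega⟩, x⟩, rfl⟩
  have hcard : Fintype.card (Fin vals.length × ((j : Fin (w + 1)) × ((r : Fin (p + 1)) ×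
      ((Fin (p - r.val) → σ) × (Fin (r.val + j.val) → σ))))) =
      vals.length * ((p + 1) * ∑ j ∈ Finset.range (w + 1), Fintype.card σ ^ (p + j)) := by
    simp only [Fintype.card_prod, Fintype.card_sigma, Fintype.card_fun, Fintype.card_fin]
    congr 1
    rw [Finset.sum_congr rfl fun (j : Fin (w + 1)) _ =>
        show ∑ r : Fin (p + 1), Fintype.card σ ^ (p - r.val) * Fintype.card σ ^ (r.val + j.val) =
            (p + 1) * Fintype.card σ ^ (p + j.val) by
          rw [Finset.sum_congr rfl fun (r : Fin (p + 1)) _ =>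
              show Fintype.card σ ^ (p - r.val) * Fintype.card σ ^ (r.val + j.val) =
                  Fintype.card σ ^ (p + j.val) by
                rw [← pow_add, show p - r.val + (r.val + j.val) = p + j.val by omega],
            Finset.sum_const, Finset.card_univ, Fintype.card_fin, smul_eq_mul],
      ← Finset.mul_sum, Fin.sum_univ_eq_sum_range (fun j => Fintype.card σ ^ (p + j)) (w + 1)]
  calc (outerFlat K p m f).rank
      = Module.finrank K (Submodule.span K (Set.range (outerFlat K p m f).row)) :=
        Matrix.rank_eq_finrank_span_row _
    _ ≤ Module.finrank K (Submodule.span K (Set.range Φ)) := by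
        apply Submodule.finrank_mono
        exact Submodule.span_le.2 (by rintro _ ⟨y, rfl⟩; exact hrows y)
    _ ≤ _ := finrank_range_le_card (R := K) Φ
    _ = vals.length * (p + 1) * ∑ j ∈ Finset.range (w + 1), Fintype.card σ ^ (p + j) := by
        rw [hcard, mul_assoc]

end Flat

/-! ## §3 `LID_r` against `(w+2)`-unbalanced circuits -/

section LID

variable (K : Type u) [Field K]

/-- Termwise bound for the notches of the dial: `Σ_{j ≤ w} n^{r+j} ≤ (w+1) · n^{r+w}` (`n ≥ 1`).
[cite: LimayeMalodSrinivasan2016, Cor. 5.7] -/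
theorem sum_pow_window_le (n r w : ℕ) (hn : 1 ≤ n) :
    ∑ j ∈ Finset.range (w + 1), n ^ (r + j) ≤ (w + 1) * n ^ (r + w) :=
  calc ∑ j ∈ Finset.range (w + 1), n ^ (r + j)
      ≤ ∑ j ∈ Finset.range (w + 1), n ^ (r + w) :=
        Finset.sum_le_sum fun j hj =>
          Nat.pow_le_pow_right hn (by have := Finset.mem_range.1 hj; omega)
    _ = (w + 1) * n ^ (r + w) := by rw [Finset.sum_const, Finset.card_range, smul_eq_mul]

/-- **`LID_r` IS EXPONENTIALLY HARD FOR `(w+2)`-UNBALANCED CIRCUITS** (LMS16 Cor. 5.7 for the lifted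
identity, explicit, every field): every fan-in-two noncommutative circuit computing `LID_r`, `r ≥ 1`,
whose product gates are `(w+2)`-unbalanced up to degree `4r` — at each product gate, read after the
gates before it, the components of the two operands of degrees `b, b' ≥ w + 2`, `b + b' ≤ 4r`, multiply
to zero — has **`2^r ≤ (r+1) · (w+1) 2^w · size`**. [cite: LimayeMalodSrinivasan2016, Cor. 5.7, Thm 5.5] -/
theorem lidPoly_unbalanced {r w : ℕ} (hr : 1 ≤ r) (P : ArithCircuit K (Fin 2)) (h2 : P.IsFanInTwo)
    (hunb : ∀ (l₁ : List (Gate K (Fin 2))) (o o' : Operand K (Fin 2)) (l₂ : List (Gate K (Fin 2))),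
      P.gates = l₁ ++ Gate.prod [o, o'] :: l₂ → ∀ b b' : ℕ, w + 2 ≤ b → w + 2 ≤ b' → b + b' ≤ 4 * r →
        degPart (4 * r) b (o.ncEval (ncGateValues l₁)) *
          degPart (4 * r) b' (o'.ncEval (ncGateValues l₁)) = 0)
    (h : P.ncEval = lidPoly K r) : 2 ^ r ≤ (r + 1) * ((w + 1) * 2 ^ w) * P.size := by
  have hmem : lidPoly K r ∈
      unbSpan (bodies (ncGateValues P.gates) (4 * r)) (4 * r) (r + 2 * r) w (4 * r) := by
    have := unbalanced_structure P h2 (d := 4 * r) (e := r + 2 * r) (w := w) hunb (by omega)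
      (by omega) (by rw [h]; exact degPart_lidPoly K r)
    rwa [h] at this
  have hrank := rank_outerFlat_unb_le K (p := r) (m := 2 * r) (d := 4 * r) (w := w) (by omega)
    (ncGateValues P.gates) hmem
  have hlen : (ncGateValues P.gates).length = P.size := by
    show _ = P.gates.length
    simpa using (ncGateValues_append_getD P.gates []).1
  rw [hlen, Fintype.card_fin] at hrank
  have hsum : ∑ j ∈ Finset.range (w + 1), 2 ^ (r + j) ≤ (w + 1) * 2 ^ w * 2 ^ r :=
    calc ∑ j ∈ Finset.range (w + 1), 2 ^ (r + j)
        ≤ (w + 1) * 2 ^ (r + w) := sum_pow_window_le 2 r w (by norm_num)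
      _ = (w + 1) * 2 ^ w * 2 ^ r := by rw [pow_add]; ring
  have h4 : 2 ^ r * 2 ^ r ≤ (r + 1) * ((w + 1) * 2 ^ w) * P.size * 2 ^ r :=
    calc 2 ^ r * 2 ^ r = 4 ^ r := (four_pow_eq_mul r).symm
      _ = (outerFlat K r (2 * r) (lidPoly K r)).rank := (rank_outerFlat_lidPoly K r).symm
      _ ≤ P.size * (r + 1) * ∑ j ∈ Finset.range (w + 1), 2 ^ (r + j) := hrank
      _ ≤ P.size * (r + 1) * ((w + 1) * 2 ^ w * 2 ^ r) := Nat.mul_le_mul_left _ hsum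
      _ = (r + 1) * ((w + 1) * 2 ^ w) * P.size * 2 ^ r := by ring
  exact Nat.le_of_mul_le_mul_right h4 (by positivity)

/- **THE SKEW END** (`w = 0`): FILE 1's `skew_unbalanced` feeds `lidPoly_unbalanced` and recovers the
statement of the landed `NcSkewPermanent.lidPoly_skew`, `2^r ≤ (r+1) · size`, character for character —
kept as an anonymous `example` (a named copy would restate a landed theorem).
[cite: LimayeMalodSrinivasan2016, Thm 5.5] -/
example {r : ℕ} (hr : 1 ≤ r) (P : ArithCircuit K (Fin 2)) (h2 : P.IsFanInTwo)
    (hs : P.IsSkew) (h : P.ncEval = lidPoly K r) : 2 ^ r ≤ (r + 1) * P.size := by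
  simpa using lidPoly_unbalanced K hr P h2 (w := 0) (skew_unbalanced P.gates hs) h

/-- **DEF. 5.6 READ SEMANTICALLY** (`δ = w + 1`): if at every product gate of a fan-in-two
noncommutative circuit computing `LID_r` one operand's value has degree `≤ w + 1` (all its
components of degrees `w + 2 ≤ b ≤ 4r + 1` vanish), then `2^r ≤ (r+1) · (w+1) 2^w · size`.
[cite: LimayeMalodSrinivasan2016, Def. 5.6, Cor. 5.7] -/
theorem lidPoly_degree {r w : ℕ} (hr : 1 ≤ r) (P : ArithCircuit K (Fin 2)) (h2 : P.IsFanInTwo)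
    (hdeg : ∀ (l₁ : List (Gate K (Fin 2))) (o o' : Operand K (Fin 2)) (l₂ : List (Gate K (Fin 2))),
      P.gates = l₁ ++ Gate.prod [o, o'] :: l₂ →
        (∀ b : ℕ, w + 2 ≤ b → b ≤ 4 * r + 1 → degPart (4 * r) b (o.ncEval (ncGateValues l₁)) = 0) ∨
        (∀ b : ℕ, w + 2 ≤ b → b ≤ 4 * r + 1 → degPart (4 * r) b (o'.ncEval (ncGateValues l₁)) = 0))
    (h : P.ncEval = lidPoly K r) : 2 ^ r ≤ (r + 1) * ((w + 1) * 2 ^ w) * P.size :=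
  lidPoly_unbalanced K hr P h2 (unbalanced_of_degree P.gates hdeg) h

end LID

end Summit.ValiantsHypothesis.ValiantsHypothesis.Theorems.NcUnbalancedRank

end
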